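import Literature.InformationTheory.Coding.BCHExplicit
import Literature.Computability.Complexity.CodeFPBudgets
import HarnessLib

/-!
# `GF(2)[X]` arithmetic on bitmask numerals, computed on codes in polynomial time

Topic `InformationTheory/Coding`, namespace `Literature.InformationTheory.Coding.GF2X`. Companion of
`BCHExplicit.lean` (binary polynomials as bitmasks: `bitsPoly n = ∑_{i ∈ bits n} Xⁱ ∈ 𝔽₂[X]`, the
canonical irreducible `f_M`, the explicit BCH parity-check matrix `bchExplicit` with its ENTRY
FORMULA `bchExplicit_apply` — coefficients of `(bitsPoly (j+1))^{2s+1} mod f_M`). A machine that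
OUTPUTS that matrix (the machine level of Khot 2005, Thm. 1.1 / Thm. 4.1: "the parity check matrix
for BCH codes … can be constructed efficiently", i.e. the one remaining hypothesis of
`Literature.Algebra.EuclideanLattices.Khot.gapSVP_const_isNPHardRandomized_of_prop6_of_FP`) computes
carry-less arithmetic on bitmasks. This file supplies that arithmetic as FUNCTIONAL PROGRAMS on `ℕ`
(folds over unit budgets), proves what they compute in `𝔽₂[X]` (through `bitsPoly`), and proves
that they are computed on codes by polynomial-time string functions in the typed algebra `CodeFP`
(`Computability/Complexity/CodeFP.lean`; binary numerals `natE`, unary budgets `unE`):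

* bridges `bitsPoly (a ^^^ b) = bitsPoly a + bitsPoly b`, `bitsPoly (2r) = X · bitsPoly r`,
  `bitsPoly (2ⁱ a + b) = Xⁱ · bitsPoly a + bitsPoly b` (`b < 2ⁱ`), the bit test `natTestBitFP`;
* `xorW W a b = (a ^^^ b) mod 2ᵂ` — bitwise sum by a fold over `W` bit positions (`xorW_eq`,
  `xorFP`);
* `mulXMod W f P r` — multiplication by `X` modulo `f` (`P = 2^{deg f}`): for `2ᵐ ≤ f < 2^{m+1}`,
  `r < 2ᵐ`, `m + 1 ≤ W`: `bitsPoly (mulXMod W f 2ᵐ r) = (X · bitsPoly r) %ₘ bitsPoly f`, `< 2ᵐ`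
  (`mulXMod_spec`, `mulXModFP`);
* `mulMod W f P n b y` — `(bitsPoly b · bitsPoly y) %ₘ bitsPoly f` for `b < 2ⁿ`, `y < 2ᵐ`, by the
  least-significant-bit-first double-and-add fold over `n` rounds (`mulMod_spec`, `mulModFP`);
* `powMod W f P n b e` — `(bitsPoly b)^e %ₘ bitsPoly f` by `e` modular products (`powMod_spec`,
  `powModFP`; `e` in unary);
* `clmul W n g h` — the carry-less product, `bitsPoly (clmul W n g h) = bitsPoly g · bitsPoly h` for
  `g, h < 2ⁿ`, `2n ≤ W` (`clmul_spec`, `clmulFP`).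

All `CodeFP` statements are unconditional (the programs are total; every fold accumulator is
bounded on ALL inputs: `xorW < 2ᵂ`, doubling adds one bit per round), so they compose freely; the
algebraic specifications carry the size hypotheses. No facts, no `sorry`.

## References

* D. E. Knuth, *The Art of Computer Programming*, Vol. 2, 3rd ed., Addison-Wesley 1998, §4.6.1
  (division of polynomials), §4.6.3 (powers by repeated multiplication); arithmetic of polynomials
  over `GF(2)` as bit operations, §4.6 ex. (schoolbook; everything is proved here).
* R. J. McEliece, *The Theory of Information and Coding*, 2nd ed., CUP 2002, Ch. 9 §9.1
  (`GF(2^m) = 𝔽₂[x]/(f)`, elements as coefficient vectors).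
* S. Arora, B. Barak, *Computational Complexity: A Modern Approach*, CUP 2009, §1.3 (closure of
  polynomial time under composition and polynomially bounded loops).
-/

namespace Literature.InformationTheory.Coding

namespace GF2X

open Polynomial
open Literature.Computability.Complexity Literature.Computability.Complexity.CodeFP

/-! ### Bridges: bit operations on bitmasks are polynomial operations -/

/-- `bitsPoly` turns `xor` into addition over `𝔽₂`. [cite: KnuthTAOCP2, §4.6] -/
theorem bitsPoly_xor (a b : ℕ) : bitsPoly (a ^^^ b) = bitsPoly a + bitsPoly b := by
  ext i
  simp only [coeff_bitsPoly, coeff_add, Nat.testBit_xor]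
  cases a.testBit i <;> cases b.testBit i <;> decide

/-- Doubling a bitmask multiplies its polynomial by `X`. [cite: KnuthTAOCP2, §4.6] -/
theorem bitsPoly_two_mul (r : ℕ) : bitsPoly (2 * r) = X * bitsPoly r := by
  ext i
  cases i with
  | zero =>
    rw [coeff_X_mul_zero, coeff_bitsPoly, Nat.testBit_zero, Nat.mul_mod_right]
    simp
  | succ i =>
    rw [coeff_X_mul, coeff_bitsPoly, coeff_bitsPoly, Nat.testBit_succ, Nat.mul_div_cancel_left r two_pos]

/-- Concatenation of bit blocks: `bitsPoly (2ⁱ a + b) = Xⁱ · bitsPoly a + bitsPoly b` for `b < 2ⁱ`.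
[cite: KnuthTAOCP2, §4.6] -/
theorem bitsPoly_two_pow_mul_add (a : ℕ) {b i : ℕ} (hb : b < 2 ^ i) :
    bitsPoly (2 ^ i * a + b) = X ^ i * bitsPoly a + bitsPoly b := by
  ext j
  rw [coeff_bitsPoly, Nat.testBit_two_pow_mul_add a hb, coeff_add, coeff_X_pow_mul', coeff_bitsPoly,
    coeff_bitsPoly]
  by_cases hj : j < i
  · simp [hj, not_le.2 hj]
  · have hb0 : b.testBit j = false :=
      Nat.testBit_lt_two_pow (hb.trans_le (Nat.pow_le_pow_right two_pos (not_lt.1 hj)))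
    simp [hj, not_lt.1 hj, hb0]

/-- One more low bit: `bitsPoly (b mod 2^{i+1}) = bitsPoly (b mod 2ⁱ) + [bit i of b] · Xⁱ`.
[cite: KnuthTAOCP2, §4.6] -/
theorem bitsPoly_mod_two_pow_succ (b i : ℕ) :
    bitsPoly (b % 2 ^ (i + 1)) = bitsPoly (b % 2 ^ i) + if b.testBit i then X ^ i else 0 := by
  rw [Nat.mod_pow_succ, add_comm (b % 2 ^ i), bitsPoly_two_pow_mul_add _ (Nat.mod_lt _ (Nat.two_pow_pos i)),
    add_comm (X ^ i * _), Nat.testBit_eq_decide_div_mod_eq]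
  congr 1
  rcases Nat.mod_two_eq_zero_or_one (b / 2 ^ i) with h | h
  · rw [h]; simp
  · rw [h]; simp

/-- A bitmask in `[2ᵐ, 2^{m+1})` has bit `m` set. [folklore] -/
theorem testBit_of_mem {x m : ℕ} (h1 : 2 ^ m ≤ x) (h2 : x < 2 ^ (m + 1)) : x.testBit m = true := by
  have hlt : x - 2 ^ m < 2 ^ m := by rw [pow_succ] at h2; omega
  rw [show x = 2 ^ m + (x - 2 ^ m) by omega, Nat.testBit_two_pow_add_eq, Nat.testBit_lt_two_pow hlt]
  rfl

/-- A bitmask `< 2^{m+1}` with bit `m` clear is `< 2ᵐ`. [folklore] -/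
theorem lt_of_testBit_eq_false {x m : ℕ} (h2 : x < 2 ^ (m + 1)) (hb : x.testBit m = false) : x < 2 ^ m := by
  by_contra h
  rw [testBit_of_mem (not_lt.1 h) h2] at hb
  exact Bool.noConfusion hb

/-- The polynomial of a bitmask `< 2ᵐ` reduces to itself modulo a monic of degree `m`. [folklore] -/
theorem modByMonic_bitsPoly_of_lt {y m : ℕ} {F : (ZMod 2)[X]} (hF : F.Monic) (hdeg : F.degree = m)
    (hy : y < 2 ^ m) : bitsPoly y %ₘ F = bitsPoly y :=
  (modByMonic_eq_self_iff hF).2 (hdeg ▸ degree_bitsPoly_lt hy)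

/-- Reducing one factor first does not change a product modulo a monic. [folklore] -/
theorem mul_modByMonic_mod {R : Type*} [CommRing R] [Nontrivial R] (a c F : R[X]) (hF : F.Monic) :
    (a * (c %ₘ F)) %ₘ F = (a * c) %ₘ F := by
  rw [mul_modByMonic, mul_modByMonic a c]
  congr 2
  exact (modByMonic_eq_self_iff hF).2 (degree_modByMonic_lt _ hF)

/-! ### Bitwise sum by a fold over bit positions -/

/-- One round of the bitwise-sum loop on the state `(acc, a', b', 2ⁱ)`: add the sum of the two low
bits modulo `2` at the current position, halve both operands, double the position.
[cite: KnuthTAOCP2, §4.6] -/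
def xorStep (st : ℕ × ℕ × ℕ × ℕ) : ℕ × ℕ × ℕ × ℕ :=
  (st.1 + (st.2.1 % 2 + st.2.2.1 % 2) % 2 * st.2.2.2, st.2.1 / 2, st.2.2.1 / 2, st.2.2.2 * 2)

/-- **Bitwise sum of the low `W` bits**: `W` rounds of `xorStep` from `(0, a, b, 1)`.
[cite: KnuthTAOCP2, §4.6] -/
def xorW (W a b : ℕ) : ℕ :=
  ((List.replicate W ()).foldl (fun st _ => xorStep st) (0, a, b, 1)).1

/-- Bit `i` of `a ^^^ b` in arithmetic form. [folklore] -/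
theorem xor_div_two_pow_mod_two (a b i : ℕ) :
    (a ^^^ b) / 2 ^ i % 2 = (a / 2 ^ i % 2 + b / 2 ^ i % 2) % 2 := by
  have h := Nat.testBit_xor a b i
  simp only [Nat.testBit_eq_decide_div_mod_eq] at h
  rcases Nat.mod_two_eq_zero_or_one ((a ^^^ b) / 2 ^ i) with h0 | h0 <;>
  rcases Nat.mod_two_eq_zero_or_one (a / 2 ^ i) with h1 | h1 <;>
  rcases Nat.mod_two_eq_zero_or_one (b / 2 ^ i) with h2 | h2 <;>
  simp [h0, h1, h2] at h ⊢

/-- The loop invariant of `xorW`: after the rounds of `l` from position `i`, the state is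
`((a ^^^ b) mod 2^{i+|l|}, a / 2^{i+|l|}, b / 2^{i+|l|}, 2^{i+|l|})`. [cite: KnuthTAOCP2, §4.6] -/
theorem foldl_xorStep (a b : ℕ) (l : List Unit) (i : ℕ) :
    l.foldl (fun st _ => xorStep st) ((a ^^^ b) % 2 ^ i, a / 2 ^ i, b / 2 ^ i, 2 ^ i) =
      ((a ^^^ b) % 2 ^ (i + l.length), a / 2 ^ (i + l.length), b / 2 ^ (i + l.length), 2 ^ (i + l.length)) := by
  induction l generalizing i with
  | nil => simp
  | cons u l ih =>
    rw [List.foldl_cons]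
    have hstep : xorStep ((a ^^^ b) % 2 ^ i, a / 2 ^ i, b / 2 ^ i, 2 ^ i) =
        ((a ^^^ b) % 2 ^ (i + 1), a / 2 ^ (i + 1), b / 2 ^ (i + 1), 2 ^ (i + 1)) := by
      simp only [xorStep, Prod.mk.injEq]
      refine ⟨?_, ?_, ?_, ?_⟩
      · rw [Nat.mod_pow_succ, xor_div_two_pow_mod_two, mul_comm]
      · rw [Nat.div_div_eq_div_mul, ← pow_succ]
      · rw [Nat.div_div_eq_div_mul, ← pow_succ]
      · rw [← pow_succ]
    rw [hstep, ih (i + 1), List.length_cons, show i + (l.length + 1) = i + 1 + l.length by omega]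

/-- **`xorW W a b = (a ^^^ b) mod 2ᵂ`.** [cite: KnuthTAOCP2, §4.6] -/
theorem xorW_eq (W a b : ℕ) : xorW W a b = (a ^^^ b) % 2 ^ W := by
  have h := foldl_xorStep a b (List.replicate W ()) 0
  simp only [pow_zero, Nat.mod_one, Nat.div_one, zero_add, List.length_replicate] at h
  rw [xorW, h]

/-- `xorW W a b = a ^^^ b` for `a, b < 2ᵂ`. [cite: KnuthTAOCP2, §4.6] -/
theorem xorW_eq_of_lt {W a b : ℕ} (ha : a < 2 ^ W) (hb : b < 2 ^ W) : xorW W a b = a ^^^ b := by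
  rw [xorW_eq, Nat.mod_eq_of_lt (Nat.xor_lt_two_pow ha hb)]

/-- `xorW W a b < 2ᵂ` on every input. [folklore] -/
theorem xorW_lt (W a b : ℕ) : xorW W a b < 2 ^ W := by
  rw [xorW_eq]; exact Nat.mod_lt _ (Nat.two_pow_pos W)

/-! ### The bitwise sum on codes -/

/-- Code of the four-numeral loop state. [folklore] -/
abbrev st4E : ℕ × ℕ × ℕ × ℕ → List Bool := pairE natE (pairE natE (pairE natE natE))

/-- `xorStep` is computed on codes. [cite: AroraBarak2009, §1.3] -/
theorem xorStepFP : CodeFP st4E st4E xorStep := by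
  have h0 : CodeFP st4E natE (fun st => st.1) := fst _ _
  have h1 : CodeFP st4E natE (fun st => st.2.1) := (snd _ _).fst'
  have h2 : CodeFP st4E natE (fun st => st.2.2.1) := (snd _ _).snd'.fst'
  have h3 : CodeFP st4E natE (fun st => st.2.2.2) := (snd _ _).snd'.snd'
  have two : CodeFP st4E natE (fun _ => (2 : ℕ)) := const _ 2
  have hacc : CodeFP st4E natE (fun st => st.1 + (st.2.1 % 2 + st.2.2.1 % 2) % 2 * st.2.2.2) :=
    natAdd.comp (h0.pair (natMul.comp ((natMod.comp ((natAdd.comp ((natMod.comp (h1.pair two)).pair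
      (natMod.comp (h2.pair two)))).pair two)).pair h3)))
  exact (hacc.pair ((natDiv.comp (h1.pair two)).pair ((natDiv.comp (h2.pair two)).pair
    (natMul.comp (h3.pair two))))).congr fun st => rfl

/-- **`(1ᵂ, a, b) ↦ xorW W a b` is computed on codes in polynomial time** (a fold of `W` rounds whose
state has `O(W + |a| + |b|)` bits). [cite: AroraBarak2009, §1.3] -/
theorem xorFP : CodeFP (pairE unE (pairE natE natE)) natE (fun p => xorW p.1 p.2.1 p.2.2) := by
  have hstep : CodeFP (pairE (pairE natE natE) (pairE unitE st4E)) st4E (fun t => xorStep t.2.2) :=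
    xorStepFP.comp (snd _ _).snd'
  have hinit : CodeFP (pairE natE natE) st4E (fun s => ((0 : ℕ), s.1, s.2, (1 : ℕ))) :=
    (const _ 0).pair ((fst _ _).pair ((snd _ _).pair (const _ 1)))
  have h := foldl (σ := ℕ × ℕ) (α := Unit) (eσ := pairE natE natE) (eα := unitE) (eβ := st4E)
    (step := fun _ _ st => xorStep st) (init := fun s => (0, s.1, s.2, 1)) hstep hinit (3 * X + 7)
    (fun s l₁ l₂ => by
      obtain ⟨a, b⟩ := s
      have hf := foldl_xorStep a b l₁ 0
      simp only [pow_zero, Nat.mod_one, Nat.div_one, zero_add] at hf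
      rw [hf]
      simp only [pairE_apply, length_boolPair, eval_add, eval_mul, eval_ofNat, eval_X, length_natE]
      have h1 : Nat.size ((a ^^^ b) % 2 ^ l₁.length) ≤ l₁.length := Nat.size_le.2 (Nat.mod_lt _ (Nat.two_pow_pos _))
      have h2 : Nat.size (a / 2 ^ l₁.length) ≤ Nat.size a := Nat.size_le_size (Nat.div_le_self _ _)
      have h3 : Nat.size (b / 2 ^ l₁.length) ≤ Nat.size b := Nat.size_le_size (Nat.div_le_self _ _)
      have h4 : Nat.size (2 ^ l₁.length) = l₁.length + 1 := Nat.size_pow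
      have h5 : l₁.length ≤ (rawE unitE (l₁ ++ l₂)).length :=
        le_trans (by simp) (length_le_length_rawE unitE (l₁ ++ l₂))
      omega)
  exact (h.fst'.comp ((snd _ _).pair (replicateUnit.comp (fst _ _)))).congr fun p => rfl

/-- **The bit test `(x, 1ˡ) ↦ [bit l of x]`** on codes (`x / 2ˡ mod 2 = 1`). [cite: AroraBarak2009, §1.3] -/
theorem natTestBitFP : CodeFP (pairE natE unE) bitE (fun p => p.1.testBit p.2) :=
  ((natEq.comp ((natMod.comp ((natDiv.comp ((fst _ _).pair (natPow.comp ((const _ 2).pair (snd _ _))))).pair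
    (const _ 2))).pair (const _ 1))).congr fun p => by rw [Nat.testBit_eq_decide_div_mod_eq])


/-! ### Multiplication by `X` modulo `f` -/

/-- **Multiplication by `X` modulo `f`** on reduced bitmasks (`P = 2^{deg f}`): double, and if the
bit of weight `P` appears, cancel it with `f`. [cite: KnuthTAOCP2, §4.6.1] -/
def mulXMod (W f P r : ℕ) : ℕ :=
  if 2 * r / P % 2 = 1 then xorW W (2 * r) f else 2 * r

/-- **What `mulXMod` computes**: for `2ᵐ ≤ f < 2^{m+1}` (degree `m`), `r < 2ᵐ` (reduced) and a
width `W ≥ m + 1`, `bitsPoly (mulXMod W f 2ᵐ r) = (X · bitsPoly r) %ₘ bitsPoly f`, again reduced.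
[cite: KnuthTAOCP2, §4.6.1] -/
theorem mulXMod_spec {m f W r : ℕ} (hf1 : 2 ^ m ≤ f) (hf2 : f < 2 ^ (m + 1)) (hW : m + 1 ≤ W)
    (hr : r < 2 ^ m) :
    bitsPoly (mulXMod W f (2 ^ m) r) = (X * bitsPoly r) %ₘ bitsPoly f ∧ mulXMod W f (2 ^ m) r < 2 ^ m := by
  have hmonic := monic_bitsPoly_of_mem hf1 hf2
  have hdegf : (bitsPoly f).degree = m := by
    rw [degree_eq_natDegree hmonic.ne_zero, natDegree_bitsPoly_of_mem hf1 hf2]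
  have h2r : 2 * r < 2 ^ (m + 1) := by rw [pow_succ]; omega
  have hWm : 2 ^ (m + 1) ≤ 2 ^ W := Nat.pow_le_pow_right two_pos hW
  unfold mulXMod
  by_cases htop : (2 * r).testBit m = true
  · have hcond : 2 * r / 2 ^ m % 2 = 1 := by
      rwa [Nat.testBit_eq_decide_div_mod_eq, decide_eq_true_eq] at htop
    rw [if_pos hcond, xorW_eq_of_lt (h2r.trans_le hWm) (hf2.trans_le hWm), bitsPoly_xor, bitsPoly_two_mul]
    have hle : 2 ^ m ≤ 2 * r := by
      by_contra hlt
      rw [Nat.testBit_lt_two_pow (not_le.1 hlt)] at htop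
      exact Bool.noConfusion htop
    have hmonic2 := monic_bitsPoly_of_mem hle h2r
    have hdeg2 : (bitsPoly (2 * r)).degree = m := by
      rw [degree_eq_natDegree hmonic2.ne_zero, natDegree_bitsPoly_of_mem hle h2r]
    constructor
    · have hsub : (X * bitsPoly r + bitsPoly f).degree < (bitsPoly f).degree := by
        rw [← bitsPoly_two_mul, ← CharTwo.sub_eq_add, hdegf, ← hdeg2]
        exact degree_sub_lt (hdeg2.trans hdegf.symm) hmonic2.ne_zero (by rw [hmonic2.leadingCoeff, hmonic.leadingCoeff])
      refine ((div_modByMonic_unique 1 (X * bitsPoly r + bitsPoly f) hmonic ⟨?_, hsub⟩).2).symm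
      rw [mul_one, add_assoc, CharTwo.add_self_eq_zero, add_zero]
    · refine Nat.lt_pow_two_of_testBit _ fun i hi => ?_
      rw [Nat.testBit_xor]
      rcases hi.eq_or_lt with rfl | hlt
      · rw [htop, testBit_of_mem hf1 hf2]; rfl
      · have hi' : 2 ^ (m + 1) ≤ 2 ^ i := Nat.pow_le_pow_right two_pos hlt
        rw [Nat.testBit_lt_two_pow (h2r.trans_le hi'), Nat.testBit_lt_two_pow (hf2.trans_le hi')]; rfl
  · have hcond : ¬(2 * r / 2 ^ m % 2 = 1) := by
      rwa [Nat.testBit_eq_decide_div_mod_eq, decide_eq_true_eq] at htop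
    rw [if_neg hcond, bitsPoly_two_mul]
    have hlt : 2 * r < 2 ^ m := lt_of_testBit_eq_false h2r (Bool.eq_false_iff.2 htop)
    refine ⟨?_, hlt⟩
    rw [← bitsPoly_two_mul]
    exact (modByMonic_bitsPoly_of_lt hmonic hdegf hlt).symm

/-- On every input `mulXMod` either stays below `2ᵂ` or is the plain double (the bound used for
the loops). [folklore] -/
theorem mulXMod_lt_or (W f P r : ℕ) : mulXMod W f P r < 2 ^ W ∨ mulXMod W f P r = 2 * r := by
  unfold mulXMod
  split_ifs
  · exact Or.inl (xorW_lt _ _ _)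
  · exact Or.inr rfl

/-- Size of `mulXMod` on every input. [folklore] -/
theorem size_mulXMod_le (W f P r : ℕ) : Nat.size (mulXMod W f P r) ≤ max W (Nat.size r + 1) := by
  rcases mulXMod_lt_or W f P r with h | h
  · exact (Nat.size_le.2 h).trans (le_max_left _ _)
  · rw [h]
    refine le_trans ?_ (le_max_right _ _)
    rcases Nat.eq_zero_or_pos r with rfl | hr
    · simp
    · rw [Nat.size_le, pow_succ]
      have := Nat.lt_size_self r
      omega

/-- Code of a `GF(2)[X]` context `(1ᵂ, f, P)`: width, modulus, `2^{deg f}`. [folklore] -/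
abbrev ctxE : ℕ × ℕ × ℕ → List Bool := pairE unE (pairE natE natE)

/-- **`((1ᵂ, f, P), r) ↦ mulXMod W f P r` on codes.** [cite: AroraBarak2009, §1.3] -/
theorem mulXModFP : CodeFP (pairE ctxE natE) natE (fun p => mulXMod p.1.1 p.1.2.1 p.1.2.2 p.2) := by
  have hW : CodeFP (pairE ctxE natE) unE (fun p => p.1.1) := (fst _ _).fst'
  have hf : CodeFP (pairE ctxE natE) natE (fun p => p.1.2.1) := (fst _ _).snd'.fst'
  have hP : CodeFP (pairE ctxE natE) natE (fun p => p.1.2.2) := (fst _ _).snd'.snd'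
  have h2r : CodeFP (pairE ctxE natE) natE (fun p => 2 * p.2) := natMul.comp ((const _ 2).pair (snd _ _))
  have htest : CodeFP (pairE ctxE natE) bitE (fun p => decide (2 * p.2 / p.1.2.2 % 2 = 1)) :=
    natEq.comp ((natMod.comp ((natDiv.comp (h2r.pair hP)).pair (const _ 2))).pair (const _ 1))
  have hx : CodeFP (pairE ctxE natE) natE (fun p => xorW p.1.1 (2 * p.2) p.1.2.1) :=
    xorFP.comp (hW.pair (h2r.pair hf))
  exact (htest.ite hx h2r).congr fun p => by simp only [mulXMod, decide_eq_true_eq]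

/-! ### Modular product: least-significant-bit-first double-and-add -/

/-- One round of the modular product loop on the state `(acc, p, b')` (`p = Xⁱ y mod f`,
`b' = b / 2ⁱ`): add `p` if the current bit of `b` is set, multiply `p` by `X` modulo `f`, shift
`b'`. [cite: KnuthTAOCP2, §4.6.3] -/
def mulModStep (W f P : ℕ) (st : ℕ × ℕ × ℕ) : ℕ × ℕ × ℕ :=
  (if st.2.2 % 2 = 1 then xorW W st.1 st.2.1 else st.1, mulXMod W f P st.2.1, st.2.2 / 2)

/-- **Modular product** `(bitsPoly b · bitsPoly y) mod f` by `n` rounds of `mulModStep` over the bits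
of `b` (any `b < 2ⁿ`; `y` reduced). [cite: KnuthTAOCP2, §4.6.3] -/
def mulMod (W f P n b y : ℕ) : ℕ :=
  ((List.replicate n ()).foldl (fun st _ => mulModStep W f P st) (0, y, b)).1

/-- The loop invariant of `mulMod`. [cite: KnuthTAOCP2, §4.6.3] -/
theorem foldl_mulModStep_spec {m f W : ℕ} (hf1 : 2 ^ m ≤ f) (hf2 : f < 2 ^ (m + 1)) (hW : m + 1 ≤ W)
    (b y : ℕ) (l : List Unit) :
    ∀ (i acc p : ℕ), acc < 2 ^ m → p < 2 ^ m →
      bitsPoly acc = (bitsPoly (b % 2 ^ i) * bitsPoly y) %ₘ bitsPoly f →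
      bitsPoly p = (X ^ i * bitsPoly y) %ₘ bitsPoly f →
      (l.foldl (fun st _ => mulModStep W f (2 ^ m) st) (acc, p, b / 2 ^ i)).1 < 2 ^ m ∧
        bitsPoly (l.foldl (fun st _ => mulModStep W f (2 ^ m) st) (acc, p, b / 2 ^ i)).1 =
          (bitsPoly (b % 2 ^ (i + l.length)) * bitsPoly y) %ₘ bitsPoly f := by
  have hmonic := monic_bitsPoly_of_mem hf1 hf2
  have hmW : 2 ^ m ≤ 2 ^ W := Nat.pow_le_pow_right two_pos (by omega)
  induction l with
  | nil =>
    intro i acc p hacc _ hacc' _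
    simpa using And.intro hacc hacc'
  | cons u l ih =>
    intro i acc p hacc hp hacc' hp'
    rw [List.foldl_cons, List.length_cons, show i + (l.length + 1) = i + 1 + l.length by omega]
    have hstate : mulModStep W f (2 ^ m) (acc, p, b / 2 ^ i) =
        (if b / 2 ^ i % 2 = 1 then xorW W acc p else acc, mulXMod W f (2 ^ m) p, b / 2 ^ (i + 1)) := by
      simp only [mulModStep, Nat.div_div_eq_div_mul, ← pow_succ]
    rw [hstate]
    obtain ⟨hp1, hp2⟩ := mulXMod_spec hf1 hf2 hW hp
    refine ih (i + 1) _ _ ?_ hp2 ?_ ?_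
    · split_ifs
      · rw [xorW_eq_of_lt (hacc.trans_le hmW) (hp.trans_le hmW)]; exact Nat.xor_lt_two_pow hacc hp
      · exact hacc
    · rw [bitsPoly_mod_two_pow_succ, add_mul, add_modByMonic, ← hacc', Nat.testBit_eq_decide_div_mod_eq]
      by_cases hbit : b / 2 ^ i % 2 = 1
      · rw [if_pos hbit, xorW_eq_of_lt (hacc.trans_le hmW) (hp.trans_le hmW), bitsPoly_xor, hp']
        simp [hbit]
      · rw [if_neg hbit]
        simp [hbit]
    · rw [hp1, hp', mul_modByMonic_mod _ _ _ hmonic, ← mul_assoc, ← pow_succ']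

/-- **What `mulMod` computes**: for `2ᵐ ≤ f < 2^{m+1}`, `W ≥ m + 1`, `b < 2ⁿ` and `y < 2ᵐ`,
`bitsPoly (mulMod W f 2ᵐ n b y) = (bitsPoly b · bitsPoly y) %ₘ bitsPoly f`, a reduced bitmask.
[cite: KnuthTAOCP2, §4.6.3] -/
theorem mulMod_spec {m f W n b y : ℕ} (hf1 : 2 ^ m ≤ f) (hf2 : f < 2 ^ (m + 1)) (hW : m + 1 ≤ W)
    (hb : b < 2 ^ n) (hy : y < 2 ^ m) :
    bitsPoly (mulMod W f (2 ^ m) n b y) = (bitsPoly b * bitsPoly y) %ₘ bitsPoly f ∧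
      mulMod W f (2 ^ m) n b y < 2 ^ m := by
  have hmonic := monic_bitsPoly_of_mem hf1 hf2
  have hdegf : (bitsPoly f).degree = m := by
    rw [degree_eq_natDegree hmonic.ne_zero, natDegree_bitsPoly_of_mem hf1 hf2]
  have h := foldl_mulModStep_spec hf1 hf2 hW b y (List.replicate n ()) 0 0 y (Nat.two_pow_pos m) hy
    (by rw [pow_zero, Nat.mod_one, bitsPoly_zero, zero_mul, zero_modByMonic])
    (by rw [pow_zero, one_mul, modByMonic_bitsPoly_of_lt hmonic hdegf hy])
  simp only [pow_zero, Nat.div_one, zero_add, List.length_replicate, Nat.mod_eq_of_lt hb] at h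
  exact ⟨h.2, h.1⟩

/-- The accumulator of `mulMod` stays below `2ᵂ` on every input. [folklore] -/
theorem foldl_mulModStep_fst_lt (W f P : ℕ) (l : List Unit) :
    ∀ st : ℕ × ℕ × ℕ, st.1 < 2 ^ W → (l.foldl (fun st _ => mulModStep W f P st) st).1 < 2 ^ W := by
  induction l with
  | nil => intro st h; simpa using h
  | cons u l ih =>
    intro st h
    rw [List.foldl_cons]
    refine ih _ ?_
    simp only [mulModStep]
    split_ifs
    · exact xorW_lt _ _ _
    · exact h

/-- Sizes along the `mulMod` loop on every input: the accumulator has at most `W` bits, the running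
multiple gains at most one bit per round, the shifted operand shrinks. [folklore] -/
theorem foldl_mulModStep_bound (W f P : ℕ) (l : List Unit) :
    ∀ (st : ℕ × ℕ × ℕ) (K c : ℕ), st.1 < 2 ^ W → Nat.size st.2.1 ≤ K → W ≤ K → st.2.2 ≤ c →
      (l.foldl (fun st _ => mulModStep W f P st) st).1 < 2 ^ W ∧
        Nat.size (l.foldl (fun st _ => mulModStep W f P st) st).2.1 ≤ K + l.length ∧
        (l.foldl (fun st _ => mulModStep W f P st) st).2.2 ≤ c := by
  induction l with
  | nil => intro st K c h1 h2 _ h4; simpa using ⟨h1, h2, h4⟩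
  | cons u l ih =>
    intro st K c h1 h2 h3 h4
    rw [List.foldl_cons, List.length_cons, ← add_assoc, Nat.add_right_comm]
    refine ih (mulModStep W f P st) (K + 1) c ?_ ?_ (by omega) ?_
    · simp only [mulModStep]
      split_ifs
      · exact xorW_lt _ _ _
      · exact h1
    · simp only [mulModStep]
      refine (size_mulXMod_le _ _ _ _).trans ?_
      omega
    · simp only [mulModStep]
      exact (Nat.div_le_self _ _).trans h4

/-- `mulMod W f P n b y < 2ᵂ` on every input. [folklore] -/
theorem mulMod_lt (W f P n b y : ℕ) : mulMod W f P n b y < 2 ^ W :=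
  foldl_mulModStep_fst_lt W f P _ _ (Nat.two_pow_pos W)

/-- Code of the three-numeral loop state. [folklore] -/
abbrev st3E : ℕ × ℕ × ℕ → List Bool := pairE natE (pairE natE natE)

/-- `mulModStep` is computed on codes (context `(1ᵂ, f, P)`). [cite: AroraBarak2009, §1.3] -/
theorem mulModStepFP :
    CodeFP (pairE ctxE st3E) st3E (fun q => mulModStep q.1.1 q.1.2.1 q.1.2.2 q.2) := by
  have hacc : CodeFP (pairE ctxE st3E) natE (fun q => q.2.1) := (snd _ _).fst'
  have hp : CodeFP (pairE ctxE st3E) natE (fun q => q.2.2.1) := (snd _ _).snd'.fst'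
  have hb : CodeFP (pairE ctxE st3E) natE (fun q => q.2.2.2) := (snd _ _).snd'.snd'
  have hW : CodeFP (pairE ctxE st3E) unE (fun q => q.1.1) := (fst _ _).fst'
  have htest : CodeFP (pairE ctxE st3E) bitE (fun q => decide (q.2.2.2 % 2 = 1)) :=
    natEq.comp ((natMod.comp (hb.pair (const _ 2))).pair (const _ 1))
  have hx : CodeFP (pairE ctxE st3E) natE (fun q => xorW q.1.1 q.2.1 q.2.2.1) :=
    xorFP.comp (hW.pair (hacc.pair hp))
  have hm : CodeFP (pairE ctxE st3E) natE (fun q => mulXMod q.1.1 q.1.2.1 q.1.2.2 q.2.2.1) :=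
    mulXModFP.comp ((fst _ _).pair hp)
  exact ((htest.ite hx hacc).pair (hm.pair (natDiv.comp (hb.pair (const _ 2))))).congr fun q => by
    simp only [mulModStep, decide_eq_true_eq]

/-- **`((1ᵂ, f, P), 1ⁿ, b, y) ↦ mulMod W f P n b y` is computed on codes in polynomial time.**
[cite: AroraBarak2009, §1.3; KnuthTAOCP2, §4.6.3] -/
theorem mulModFP : CodeFP (pairE ctxE (pairE unE (pairE natE natE))) natE
    (fun p => mulMod p.1.1 p.1.2.1 p.1.2.2 p.2.1 p.2.2.1 p.2.2.2) := by
  -- context `σ = ((W, f, P), (b, y))`, budget items `()`, state `(acc, p, b')`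
  let σE : (ℕ × ℕ × ℕ) × (ℕ × ℕ) → List Bool := pairE ctxE (pairE natE natE)
  have hstep : CodeFP (pairE σE (pairE unitE st3E)) st3E
      (fun t => mulModStep t.1.1.1 t.1.1.2.1 t.1.1.2.2 t.2.2) :=
    (mulModStepFP.comp ((fst _ _).fst'.pair (snd _ _).snd') :)
  have hinit : CodeFP σE st3E (fun s => ((0 : ℕ), s.2.2, s.2.1)) :=
    (const _ 0).pair ((snd _ _).snd'.pair (snd _ _).fst')
  have h := foldl (α := Unit) (eσ := σE) (eα := unitE) (eβ := st3E)
    (step := fun (s : (ℕ × ℕ × ℕ) × (ℕ × ℕ)) _ st => mulModStep s.1.1 s.1.2.1 s.1.2.2 st)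
    (init := fun s => (0, s.2.2, s.2.1)) hstep hinit (6 * X + 6)
    (fun s l₁ l₂ => by
      obtain ⟨⟨W, f, P⟩, b, y⟩ := s
      obtain ⟨h1, h2, h3⟩ := foldl_mulModStep_bound W f P l₁ (0, y, b) (max W (Nat.size y)) b
        (Nat.two_pow_pos W) (le_max_right _ _) (le_max_left _ _) le_rfl
      set st := l₁.foldl (fun st _ => mulModStep W f P st) (0, y, b)
      simp only [σE, pairE_apply, length_boolPair, eval_add, eval_mul, eval_ofNat, eval_X, length_natE,
        length_unE]
      have h1' : Nat.size st.1 ≤ W := Nat.size_le.2 h1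
      have h3' : Nat.size st.2.2 ≤ Nat.size b := Nat.size_le_size h3
      have h5 : l₁.length ≤ (rawE unitE (l₁ ++ l₂)).length :=
        le_trans (by simp) (length_le_length_rawE unitE (l₁ ++ l₂))
      have hmax : max W (Nat.size y) ≤ W + Nat.size y := max_le (Nat.le_add_right _ _) (Nat.le_add_left _ _)
      omega)
  exact (h.fst'.comp ((((fst _ _).pair (snd _ _).snd')).pair (replicateUnit.comp (snd _ _).fst'))).congr
    fun p => rfl

/-! ### Modular powers -/

/-- **Modular power** `(bitsPoly b)^e mod f` by `e` modular products (`e` in unary; the accumulator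
is the reduced operand of `mulMod`). [cite: KnuthTAOCP2, §4.6.3] -/
def powMod (W f P n b e : ℕ) : ℕ :=
  (List.replicate e ()).foldl (fun acc _ => mulMod W f P n b acc) 1

/-- The loop invariant of `powMod`. [cite: KnuthTAOCP2, §4.6.3] -/
theorem foldl_powMod_spec {m f W n b : ℕ} (hf1 : 2 ^ m ≤ f) (hf2 : f < 2 ^ (m + 1))
    (hW : m + 1 ≤ W) (hb : b < 2 ^ n) (l : List Unit) :
    ∀ (i acc : ℕ), acc < 2 ^ m → bitsPoly acc = bitsPoly b ^ i %ₘ bitsPoly f →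
      l.foldl (fun acc _ => mulMod W f (2 ^ m) n b acc) acc < 2 ^ m ∧
        bitsPoly (l.foldl (fun acc _ => mulMod W f (2 ^ m) n b acc) acc) = bitsPoly b ^ (i + l.length) %ₘ bitsPoly f := by
  have hmonic := monic_bitsPoly_of_mem hf1 hf2
  induction l with
  | nil => intro i acc h1 h2; simpa using ⟨h1, h2⟩
  | cons u l ih =>
    intro i acc h1 h2
    rw [List.foldl_cons, List.length_cons, show i + (l.length + 1) = i + 1 + l.length by omega]
    obtain ⟨hs1, hs2⟩ := mulMod_spec (n := n) hf1 hf2 hW hb h1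
    refine ih (i + 1) _ hs2 ?_
    rw [hs1, h2, mul_modByMonic_mod _ _ _ hmonic, ← pow_succ']

/-- **What `powMod` computes**: for `m ≥ 1`, `2ᵐ ≤ f < 2^{m+1}`, `W ≥ m + 1`, `b < 2ⁿ`,
`bitsPoly (powMod W f 2ᵐ n b e) = (bitsPoly b)^e %ₘ bitsPoly f`, a reduced bitmask.
[cite: KnuthTAOCP2, §4.6.3] -/
theorem powMod_spec {m f W n b : ℕ} (hm : 1 ≤ m) (hf1 : 2 ^ m ≤ f) (hf2 : f < 2 ^ (m + 1))
    (hW : m + 1 ≤ W) (hb : b < 2 ^ n) (e : ℕ) :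
    bitsPoly (powMod W f (2 ^ m) n b e) = bitsPoly b ^ e %ₘ bitsPoly f ∧ powMod W f (2 ^ m) n b e < 2 ^ m := by
  have hmonic := monic_bitsPoly_of_mem hf1 hf2
  have hdegf : (bitsPoly f).degree = m := by
    rw [degree_eq_natDegree hmonic.ne_zero, natDegree_bitsPoly_of_mem hf1 hf2]
  have h1 : (1 : ℕ) < 2 ^ m := Nat.one_lt_two_pow (by omega)
  have h := foldl_powMod_spec hf1 hf2 hW hb (List.replicate e ()) 0 1 h1
    (by rw [pow_zero, bitsPoly_one, ← bitsPoly_one, modByMonic_bitsPoly_of_lt hmonic hdegf h1])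
  simp only [zero_add, List.length_replicate] at h
  exact ⟨h.2, h.1⟩

/-- `powMod W f P n b e ≤ 2ᵂ` on every input. [folklore] -/
theorem powMod_le (W f P n b e : ℕ) : powMod W f P n b e ≤ 2 ^ W := by
  unfold powMod
  cases e with
  | zero => simpa using Nat.one_le_two_pow
  | succ e =>
    rw [List.replicate_succ', List.foldl_append, List.foldl_cons, List.foldl_nil]
    exact (mulMod_lt _ _ _ _ _ _).le

/-- The accumulator of `powMod` along the loop is at most `2ᵂ`. [folklore] -/
theorem foldl_powMod_le (W f P n b : ℕ) (l : List Unit) (acc : ℕ) (h : acc ≤ 2 ^ W) :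
    l.foldl (fun acc _ => mulMod W f P n b acc) acc ≤ 2 ^ W := by
  induction l generalizing acc with
  | nil => simpa using h
  | cons u l ih => rw [List.foldl_cons]; exact ih _ (mulMod_lt _ _ _ _ _ _).le

/-- **`((1ᵂ, f, P), 1ⁿ, b, 1ᵉ) ↦ powMod W f P n b e` is computed on codes in polynomial time.**
[cite: AroraBarak2009, §1.3; KnuthTAOCP2, §4.6.3] -/
theorem powModFP : CodeFP (pairE ctxE (pairE unE (pairE natE unE))) natE
    (fun p => powMod p.1.1 p.1.2.1 p.1.2.2 p.2.1 p.2.2.1 p.2.2.2) := by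
  -- context `σ = ((W, f, P), (n, b))`, budget items `()`, state `acc`
  let σE : (ℕ × ℕ × ℕ) × (ℕ × ℕ) → List Bool := pairE ctxE (pairE unE natE)
  have hstep : CodeFP (pairE σE (pairE unitE natE)) natE
      (fun t => mulMod t.1.1.1 t.1.1.2.1 t.1.1.2.2 t.1.2.1 t.1.2.2 t.2.2) :=
    (mulModFP.comp ((fst _ _).fst'.pair ((fst _ _).snd'.fst'.pair ((fst _ _).snd'.snd'.pair (snd _ _).snd'))) :)
  have h := foldl (α := Unit) (eσ := σE) (eα := unitE) (eβ := natE)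
    (step := fun (s : (ℕ × ℕ × ℕ) × (ℕ × ℕ)) _ acc => mulMod s.1.1 s.1.2.1 s.1.2.2 s.2.1 s.2.2 acc)
    (init := fun _ => 1) hstep (const _ 1) (X + 1)
    (fun s l₁ l₂ => by
      obtain ⟨⟨W, f, P⟩, n, b⟩ := s
      have hle := foldl_powMod_le W f P n b l₁ 1 Nat.one_le_two_pow
      simp only [σE, pairE_apply, length_boolPair, eval_add, eval_X, eval_one, length_natE, length_unE]
      have h1 : Nat.size (l₁.foldl (fun acc _ => mulMod W f P n b acc) 1) ≤ W + 1 :=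
        (Nat.size_le_size hle).trans (le_of_eq Nat.size_pow)
      omega)
  exact (h.comp (((fst _ _).pair ((snd _ _).fst'.pair (snd _ _).snd'.fst')).pair
    (replicateUnit.comp (snd _ _).snd'.snd'))).congr fun p => rfl

/-! ### Carry-less product -/

/-- One round of the carry-less product loop on the state `(acc, p, g')` (`p = 2ⁱ h`, `g' = g / 2ⁱ`).
[cite: KnuthTAOCP2, §4.6] -/
def clmulStep (W : ℕ) (st : ℕ × ℕ × ℕ) : ℕ × ℕ × ℕ :=
  (if st.2.2 % 2 = 1 then xorW W st.1 st.2.1 else st.1, 2 * st.2.1, st.2.2 / 2)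

/-- **Carry-less product** of bitmasks by `n` rounds of `clmulStep` over the bits of `g`.
[cite: KnuthTAOCP2, §4.6] -/
def clmul (W n g h : ℕ) : ℕ :=
  ((List.replicate n ()).foldl (fun st _ => clmulStep W st) (0, h, g)).1

/-- `bitsPoly (2ⁱ a) = Xⁱ · bitsPoly a`. [cite: KnuthTAOCP2, §4.6] -/
theorem bitsPoly_two_pow_mul (i a : ℕ) : bitsPoly (2 ^ i * a) = X ^ i * bitsPoly a := by
  have h := bitsPoly_two_pow_mul_add a (Nat.two_pow_pos i)
  rwa [add_zero, bitsPoly_zero, add_zero] at h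

/-- The loop invariant of `clmul`. [cite: KnuthTAOCP2, §4.6] -/
theorem foldl_clmulStep_spec {W n : ℕ} (g h : ℕ) (hh : h < 2 ^ n) (hW : 2 * n ≤ W) (l : List Unit) :
    ∀ (i acc : ℕ), i + l.length ≤ n → acc < 2 ^ (i + n) → bitsPoly acc = bitsPoly (g % 2 ^ i) * bitsPoly h →
      bitsPoly (l.foldl (fun st _ => clmulStep W st) (acc, 2 ^ i * h, g / 2 ^ i)).1 =
        bitsPoly (g % 2 ^ (i + l.length)) * bitsPoly h := by
  induction l with
  | nil => intro i acc _ _ h2; simpa using h2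
  | cons u l ih =>
    intro i acc hi hacc hacc'
    rw [List.length_cons] at hi
    rw [List.foldl_cons, List.length_cons, show i + (l.length + 1) = i + 1 + l.length by omega]
    have hstate : clmulStep W (acc, 2 ^ i * h, g / 2 ^ i) =
        (if g / 2 ^ i % 2 = 1 then xorW W acc (2 ^ i * h) else acc, 2 ^ (i + 1) * h, g / 2 ^ (i + 1)) := by
      show (if g / 2 ^ i % 2 = 1 then xorW W acc (2 ^ i * h) else acc, 2 * (2 ^ i * h), g / 2 ^ i / 2) = _
      rw [Nat.div_div_eq_div_mul, ← pow_succ, pow_succ', mul_assoc]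
    rw [hstate]
    have hWle : 2 ^ (i + n) ≤ 2 ^ W := Nat.pow_le_pow_right two_pos (by omega)
    have hp : 2 ^ i * h < 2 ^ (i + n) := by
      rw [pow_add]; exact Nat.mul_lt_mul_of_pos_left hh (Nat.two_pow_pos i)
    have hmono : 2 ^ (i + n) ≤ 2 ^ (i + 1 + n) := Nat.pow_le_pow_right two_pos (by omega)
    refine ih (i + 1) _ (by omega) ?_ ?_
    · split_ifs
      · rw [xorW_eq_of_lt (hacc.trans_le hWle) (hp.trans_le hWle)]
        exact (Nat.xor_lt_two_pow hacc hp).trans_le hmono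
      · exact hacc.trans_le hmono
    · rw [bitsPoly_mod_two_pow_succ, add_mul, ← hacc', Nat.testBit_eq_decide_div_mod_eq]
      by_cases hbit : g / 2 ^ i % 2 = 1
      · rw [if_pos hbit, xorW_eq_of_lt (hacc.trans_le hWle) (hp.trans_le hWle), bitsPoly_xor,
          bitsPoly_two_pow_mul]
        simp [hbit]
      · rw [if_neg hbit]
        simp [hbit]

/-- **What `clmul` computes**: for `g, h < 2ⁿ` and `W ≥ 2n`, `bitsPoly (clmul W n g h) =
bitsPoly g · bitsPoly h`. [cite: KnuthTAOCP2, §4.6] -/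
theorem clmul_spec {W n g h : ℕ} (hg : g < 2 ^ n) (hh : h < 2 ^ n) (hW : 2 * n ≤ W) :
    bitsPoly (clmul W n g h) = bitsPoly g * bitsPoly h := by
  have h0 := foldl_clmulStep_spec g h hh hW (List.replicate n ()) 0 0 (by simp) (Nat.two_pow_pos _)
    (by rw [pow_zero, Nat.mod_one, bitsPoly_zero, zero_mul])
  simp only [pow_zero, one_mul, Nat.div_one, zero_add, List.length_replicate, Nat.mod_eq_of_lt hg] at h0
  unfold clmul
  exact h0

/-- Doubling adds at most one bit. [folklore] -/
theorem size_two_mul_le (p : ℕ) : Nat.size (2 * p) ≤ Nat.size p + 1 := by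
  rcases Nat.eq_zero_or_pos p with rfl | hp
  · simp
  · rw [Nat.size_le, pow_succ]
    have := Nat.lt_size_self p
    omega

/-- Sizes along the `clmul` loop on every input. [folklore] -/
theorem foldl_clmulStep_bound (W : ℕ) (l : List Unit) :
    ∀ (st : ℕ × ℕ × ℕ) (K c : ℕ), st.1 < 2 ^ W → Nat.size st.2.1 ≤ K → st.2.2 ≤ c →
      (l.foldl (fun st _ => clmulStep W st) st).1 < 2 ^ W ∧
        Nat.size (l.foldl (fun st _ => clmulStep W st) st).2.1 ≤ K + l.length ∧
        (l.foldl (fun st _ => clmulStep W st) st).2.2 ≤ c := by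
  induction l with
  | nil => intro st K c h1 h2 h4; simpa using ⟨h1, h2, h4⟩
  | cons u l ih =>
    intro st K c h1 h2 h4
    rw [List.foldl_cons, List.length_cons, ← add_assoc, Nat.add_right_comm]
    refine ih (clmulStep W st) (K + 1) c ?_ ?_ ?_
    · simp only [clmulStep]
      split_ifs
      · exact xorW_lt _ _ _
      · exact h1
    · simp only [clmulStep]
      exact (size_two_mul_le _).trans (by omega)
    · simp only [clmulStep]
      exact (Nat.div_le_self _ _).trans h4

/-- `clmulStep` is computed on codes (context `1ᵂ`). [cite: AroraBarak2009, §1.3] -/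
theorem clmulStepFP : CodeFP (pairE unE st3E) st3E (fun q => clmulStep q.1 q.2) := by
  have hacc : CodeFP (pairE unE st3E) natE (fun q => q.2.1) := (snd _ _).fst'
  have hp : CodeFP (pairE unE st3E) natE (fun q => q.2.2.1) := (snd _ _).snd'.fst'
  have hb : CodeFP (pairE unE st3E) natE (fun q => q.2.2.2) := (snd _ _).snd'.snd'
  have htest : CodeFP (pairE unE st3E) bitE (fun q => decide (q.2.2.2 % 2 = 1)) :=
    natEq.comp ((natMod.comp (hb.pair (const _ 2))).pair (const _ 1))
  have hx : CodeFP (pairE unE st3E) natE (fun q => xorW q.1 q.2.1 q.2.2.1) :=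
    xorFP.comp ((fst _ _).pair (hacc.pair hp))
  exact ((htest.ite hx hacc).pair ((natMul.comp ((const _ 2).pair hp)).pair
    (natDiv.comp (hb.pair (const _ 2))))).congr fun q => by simp only [clmulStep, decide_eq_true_eq]

/-- **`(1ᵂ, 1ⁿ, g, h) ↦ clmul W n g h` is computed on codes in polynomial time.**
[cite: AroraBarak2009, §1.3; KnuthTAOCP2, §4.6] -/
theorem clmulFP : CodeFP (pairE unE (pairE unE (pairE natE natE))) natE
    (fun p => clmul p.1 p.2.1 p.2.2.1 p.2.2.2) := by
  -- context `σ = (W, (g, h))`, budget items `()`, state `(acc, p, g')`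
  let σE : ℕ × (ℕ × ℕ) → List Bool := pairE unE (pairE natE natE)
  have hstep : CodeFP (pairE σE (pairE unitE st3E)) st3E (fun t => clmulStep t.1.1 t.2.2) :=
    (clmulStepFP.comp ((fst _ _).fst'.pair (snd _ _).snd') :)
  have hinit : CodeFP σE st3E (fun s => ((0 : ℕ), s.2.2, s.2.1)) :=
    (const _ 0).pair ((snd _ _).snd'.pair (snd _ _).fst')
  have h := foldl (α := Unit) (eσ := σE) (eα := unitE) (eβ := st3E)
    (step := fun (s : ℕ × (ℕ × ℕ)) _ st => clmulStep s.1 st) (init := fun s => (0, s.2.2, s.2.1)) hstep hinit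
    (6 * X + 6)
    (fun s l₁ l₂ => by
      obtain ⟨W, g, h⟩ := s
      obtain ⟨h1, h2, h3⟩ := foldl_clmulStep_bound W l₁ (0, h, g) (Nat.size h) g (Nat.two_pow_pos W) le_rfl le_rfl
      set st := l₁.foldl (fun st _ => clmulStep W st) (0, h, g)
      simp only [σE, pairE_apply, length_boolPair, eval_add, eval_mul, eval_ofNat, eval_X, length_natE,
        length_unE]
      have h1' : Nat.size st.1 ≤ W := Nat.size_le.2 h1
      have h3' : Nat.size st.2.2 ≤ Nat.size g := Nat.size_le_size h3
      have h5 : l₁.length ≤ (rawE unitE (l₁ ++ l₂)).length :=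
        le_trans (by simp) (length_le_length_rawE unitE (l₁ ++ l₂))
      omega)
  exact (h.fst'.comp (((fst _ _).pair (snd _ _).snd').pair (replicateUnit.comp (snd _ _).fst'))).congr
    fun p => rfl

end GF2X

end Literature.InformationTheory.Coding
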